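import Literature.MathematicalPhysics.QuantumLattice.FermionBoxTilingTrialState
import Literature.MathematicalPhysics.QuantumLattice.HubbardTTPrimeSourcedMeanEnergyMinimisers
import HarnessLib

/-!
# THE GIBBS VARIATIONAL PRINCIPLE for translation-covariant finite-range lattice-fermion interactions:
# `P_var(β,Ψ) = sup_{ω TI} [s̄(ω) − β e_Ψ(ω)] = lim_n n^{-d} log Tr e^{−βH^Ψ_{[0,n)^d}} = P_free(β,Ψ)`,
# with two-sided finite-box windows `|P − (log Re Z_n + βc)/n^d| ≤ |β|·col_R(n)·S_Ψ/n^d`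

Topic `Literature/MathematicalPhysics/QuantumLattice` (family `hubbard`; crew hubbard-fast S2 «T > 0 / families of models»). The tree had
the LOWER half `P_var ≤ P_free` (`VariationalPressureBoxPartitionFunctionBound`, `FermionFreeBoundaryPressureExists`) for every Hermitian
even translation-covariant finite-range `Ψ` on `ℤ^d`, and both halves only for the `t–t'` Hubbard family (`TIVariationalPressure` §4, through
thermal torus states). This file proves the UPPER half `P_free ≤ P_var` in general — Bratteli–Robinson II Thm. 6.2.40 / Araki–Moriya
Thm. 11.4 for the CAR algebra — with the periodic box-product trial states `ω̄_n` (`FermionBoxTilingProductState/TrialState`: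
`s̄(ω̄_n) ≥ S(ρ_n)/n^d`, `|e_Ψ(ω̄_n) − (Re tr(H_nρ_n) − c)/n^d| ≤ col(n)S_Ψ/n^d`) applied to the box Gibbs states `ρ_n = e^{−βH_n}/Z_n`
(`S(ρ_n) − β Re tr(ρ_n H_n) = log Z_n`):

* §1 the box Gibbs density `gibbsBoxDensity β Ψ n` (faithful, trace one, EVEN for even `Ψ`), `S − β⟨H⟩ = log Re Z`;
  `spinImbalanceInteraction_isTranslationInvariant` (the last structural fact of the grand-canonical `t–t'` family).
* §2 **THE FINITE-VOLUME FLOOR** `le_varPressure_of_box`: for EVERY `n ≥ 1` and every real `β`,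
  `(log Re Z_{[0,n)^d} + β Re(Ψ∅)_{∅∅})/n^d − |β| col_R(n) S_Ψ/n^d ≤ P_var(β,Ψ,R)` — the converse of
  `varPressure_le_log_partitionFn_box`; together **`abs_varPressure_sub_boxLogPartitionFn_le`**: ONE exactly computed box partition function
  gives a TWO-SIDED certified window of width `2|β| col_R(n) S_Ψ/n^d` on the thermodynamic-limit pressure of ANY such model.
* §3 limits: `le_varPressure_of_limit` (if `n^{-d} log Re Z_n → p` then `p ≤ P_var`, any real `β`), hence `varPressure_eq_of_limit`;
  the definition `FermionInteraction.freePressure β Ψ := limUnder …` with `tendsto_freePressure` (`β ≥ 0`, `d ≥ 1`) and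
  **`varPressure_eq_freePressure`** — THE VARIATIONAL PRINCIPLE — so every convexity / Lipschitz / tangent / Griffiths statement of
  `TIVariationalPressure` §2–§3, `LayeredVariationalPressure`, `VariationalEquilibriumCoexistence` is a statement about the physical pressure.
* §4 dictionary: `freePressure β (gcInteractionTT' t t' U μ h) = gcPressureTT'Zeeman β t t' U μ h` (`β ≥ 0`, `U ≥ 0`).

Everything is PROVED; definitions with bodies: `gibbsBoxDensity`, `FermionInteraction.freePressure`; no named fact, no number.
HONEST SCOPE: free boundary conditions along the boxes `[0,n)^d` (van Hove sequences / periodic b.c. are not treated); `β ≥ 0` wherever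
the existence of the limit (`FermionFreeBoundaryPressureExists`) is used — the floor of §2 and `le_varPressure_of_limit` hold for every real `β`.

## Tree / Mathlib search

REUSED: `boxTrialState`, `boxTrialState_isTranslationInvariant`, `le_entropyDensitySup_boxTrialState`, `abs_meanEnergy_boxTrialState_sub_le`
(`FermionBoxTiling…`); `sub_mul_le_varPressure`, `varPressure_le`, `varPressure_gcInteractionTT'_eq`, `gcInteractionTT'` (`TIVariationalPressure`);
`varPressure_le_log_partitionFn_box`, `varPressure_le_of_limit` (`VariationalPressureBoxPartitionFunctionBound`); `exists_tendsto_boxLogPartitionFn_div`,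
`tendsto_collar_div_pow` (`FermionFreeBoundaryPressureExists`); `IsHermitian.vonNeumannEntropy_gibbsDensity`, `trace_gibbsDensity`, `posDef_gibbsWeight`,
`partitionFn_pos`, `IsHermitian.partitionFn_eq_ofReal`, `parityAut_gibbsWeight`, `parityAut_localHamiltonian`, `localHamiltonian_isHermitian`;
`isHermitian/isEven/hasFiniteRange/isTranslationInvariant_linearFamily`, `numberInteraction_isTranslationInvariant`; Mathlib `Filter.Tendsto.limUnder_eq`,
`tendsto_nhds_unique`. `lean search 'freePressure|variational principle fermion|P_free'` (2026-08-28): only the lower half.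

## References

* O. Bratteli, D. W. Robinson, *OAQSM 2* (1997), Prop. 6.2.38–6.2.39 and **Thm. 6.2.40** (the variational principle `P = sup(s − βe)` for
  quantum lattice systems; periodic product trial states). [cite: BratteliRobinsonII1997, Thm. 6.2.40]
* H. Araki, H. Moriya, Rev. Math. Phys. 15 (2003) 93–198, §11 (pressure, mean entropy, variational principle Thm. 11.4 for the Fermion
  algebra). [cite: ArakiMoriya2003, Theorem 3.8 and §10]
* R. B. Israel, *Convexity in the Theory of Lattice Gases* (1979), Thm. I.2.4, Thm. II.3.1. [cite: Israel1979, Thm. I.2.4]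
* B. Simon, *The Statistical Mechanics of Lattice Gases* I (1993), §III.4 (variational principle, quantum case). [cite: Simon1993, §III.4]
-/

noncomputable section

open scoped ComplexOrder BigOperators Matrix.Norms.L2Operator
open Finset Literature.InformationTheory.Entropy

namespace Literature.MathematicalPhysics.QuantumLattice

open Matrix HubbardWave0 Literature.Probability.LatticeModels ThermodynamicLimit
open _root_.Filter
open scoped _root_.Topology

variable {d : ℕ}

/-! ### §1. Box Gibbs states; the spin-imbalance interaction is translation invariant -/

/-- **The Gibbs density matrix of the box `[0,n)^d`**: `ρ_n = e^{−βH^Ψ_{[0,n)^d}} / Z_n`. [cite: BratteliRobinsonII1997, Thm. 6.2.40] -/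
def gibbsBoxDensity (β : ℝ) (Ψ : FermionInteraction d) (n : ℕ) : FermionOp (halfOpenBox d n) :=
  (Matrix.partitionFn β (Ψ.localHamiltonian (halfOpenBox d n)))⁻¹ • Matrix.gibbsWeight β (Ψ.localHamiltonian (halfOpenBox d n))

namespace FermionInteraction

variable {Ψ : FermionInteraction d} {R : ℝ}

/-- The box Gibbs density is faithful (Hermitian `Ψ`). [cite: GustafsonSigal2003, §18.3 (18.12)] -/
theorem posDef_gibbsBoxDensity (hH : Ψ.IsHermitian) (β : ℝ) (n : ℕ) : (gibbsBoxDensity β Ψ n).PosDef := by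
  haveI : Nonempty (Finset (Orb (PolySite (halfOpenBox d n)))) := ⟨∅⟩
  have hHn := localHamiltonian_isHermitian hH (halfOpenBox d n)
  have hZ := Matrix.partitionFn_pos β hHn
  rw [gibbsBoxDensity, hHn.partitionFn_eq_ofReal, ← Complex.ofReal_inv]
  rw [hHn.partitionFn_eq_ofReal] at hZ
  have hZr : 0 < (∑ i, Real.exp (-(β * hHn.eigenvalues i))) := by exact_mod_cast hZ
  exact (Matrix.posDef_gibbsWeight β hHn).smul (Complex.zero_lt_real.2 (inv_pos.2 hZr))

/-- The box Gibbs density has trace one (Hermitian `Ψ`). [cite: GustafsonSigal2003, §18.3 (18.12)] -/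
theorem trace_gibbsBoxDensity (hH : Ψ.IsHermitian) (β : ℝ) (n : ℕ) : (gibbsBoxDensity β Ψ n).trace = 1 := by
  haveI : Nonempty (Finset (Orb (PolySite (halfOpenBox d n)))) := ⟨∅⟩
  exact Matrix.trace_gibbsDensity β _ (Matrix.partitionFn_pos β (localHamiltonian_isHermitian hH (halfOpenBox d n))).ne'

/-- The box Gibbs density of an EVEN interaction is even. [cite: ArakiMoriya2003, §4.1] -/
theorem parityAut_gibbsBoxDensity (hE : Ψ.IsEven) (β : ℝ) (n : ℕ) : parityAut (gibbsBoxDensity β Ψ n) = gibbsBoxDensity β Ψ n := by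
  rw [gibbsBoxDensity, map_smul, parityAut_gibbsWeight (parityAut_localHamiltonian hE _)]

/-- **`S(ρ_n) − β Re tr(H_n ρ_n) = log Re Z_n`** (the Gibbs state attains the finite-volume variational principle).
[cite: GustafsonSigal2003, §18.3 (18.13), Problem 18.9] [cite: Petz2008, §3.7 Exercise 13] -/
theorem vonNeumannEntropy_gibbsBoxDensity_sub (hH : Ψ.IsHermitian) (β : ℝ) (n : ℕ) :
    vonNeumannEntropy (gibbsBoxDensity β Ψ n) - β * (Ψ.localHamiltonian (halfOpenBox d n) * gibbsBoxDensity β Ψ n).trace.re =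
      Real.log (Matrix.partitionFn β (Ψ.localHamiltonian (halfOpenBox d n))).re := by
  haveI : Nonempty (Finset (Orb (PolySite (halfOpenBox d n)))) := ⟨∅⟩
  have hHn := localHamiltonian_isHermitian hH (halfOpenBox d n)
  rw [gibbsBoxDensity, hHn.vonNeumannEntropy_gibbsDensity β, Matrix.gibbsEntropy_def, Matrix.trace_mul_comm, Matrix.trace_gibbsDensity_mul]
  ring

end FermionInteraction

/-- **The spin-imbalance interaction is translation invariant** (an on-site term translates to the on-site term).
[cite: ArakiMoriya2003, §1 assumption (IV)] -/
theorem spinImbalanceInteraction_isTranslationInvariant : (spinImbalanceInteraction d).IsTranslationInvariant := by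
  intro v X
  by_cases h1 : ∃ x : Site d, X = {x}
  · obtain ⟨x, rfl⟩ := h1
    have hS : shiftSet v ({x} : Finset (Site d)) = {x + v} := shiftSet_singleton_eq v x
    have key : ∀ (S : Finset (Site d)) (hS : S = {x + v}) (hy : x + v ∈ S),
        (spinImbalanceInteraction d).Φ S = nAt (x + v) hy 0 - nAt (x + v) hy 1 := by
      rintro S rfl hy
      exact spinImbalanceInteraction_apply_singleton (x + v)
    rw [key _ hS (PolySite.add_mem_shiftSet v (Finset.mem_singleton_self x)), spinImbalanceInteraction_apply_singleton, map_sub,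
      nAt, nAt, fermionEmbed_numberOp, fermionEmbed_numberOp, PolySite.shiftEmb_pt]
  have hX : (spinImbalanceInteraction d).Φ X = 0 := spinImbalanceInteraction_apply_eq_zero fun x hx => h1 ⟨x, hx⟩
  have hS : (spinImbalanceInteraction d).Φ (shiftSet v X) = 0 :=
    spinImbalanceInteraction_apply_eq_zero fun y hy => h1 ⟨y - v, eq_singleton_of_shiftSet_eq hy⟩
  rw [hX, hS, map_zero]

/-! ### §2. The finite-volume floor on the variational pressure -/

namespace FermionInteraction

variable {Ψ : FermionInteraction d} {R : ℝ}

/-- **THE FINITE-VOLUME FLOOR** (converse of `varPressure_le_log_partitionFn_box`): for `Ψ` Hermitian, even, translation covariant of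
finite range `R` on `ℤ^d` (`d ≥ 1`), every real `β` and every `n ≥ 1`,
`(log Re Z_{[0,n)^d} + β Re(Ψ∅)_{∅∅})/n^d − |β| col_R(n) S_Ψ/n^d ≤ P_var(β,Ψ,R)` — the periodic box-product trial state of the box
Gibbs state. [cite: BratteliRobinsonII1997, Thm. 6.2.40] [cite: ArakiMoriya2003, Theorem 3.8 and §10] -/
theorem le_varPressure_of_box (hd : 0 < d) (hH : Ψ.IsHermitian) (hE : Ψ.IsEven) (hT : Ψ.IsTranslationInvariant)
    (hR : Ψ.HasFiniteRange R) (β : ℝ) {n : ℕ} (hn : 1 ≤ n) :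
    (Real.log (Matrix.partitionFn β (Ψ.localHamiltonian (halfOpenBox d n))).re + β * ((Ψ.Φ ∅) ∅ ∅).re) / (n : ℝ) ^ d -
        |β| * ((((thicken (halfOpenBox d n) R \ halfOpenBox d n).card : ℝ) *
          ∑ X ∈ (thicken ({0} : Finset (Site d)) R).powerset with (0 : Site d) ∈ X, ‖Ψ.Φ X‖) / (n : ℝ) ^ d) ≤
      Ψ.varPressure β R := by
  set ρ := gibbsBoxDensity β Ψ n with hρ
  have hpd := posDef_gibbsBoxDensity hH β n
  have htr := trace_gibbsBoxDensity hH β n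
  have hev := parityAut_gibbsBoxDensity hE β n
  rw [← hρ] at hpd htr hev
  set ν := InfVolFermionState.boxTrialState n hn ρ hev hpd.posSemidef htr with hν
  have hTI := InfVolFermionState.boxTrialState_isTranslationInvariant n hn ρ hev hpd.posSemidef htr
  have hS := InfVolFermionState.le_entropyDensitySup_boxTrialState n hn ρ hev hpd htr hd
  have hEn := InfVolFermionState.abs_meanEnergy_boxTrialState_sub_le n hn ρ hev hpd.posSemidef htr hd hT hR
  have hP := Ψ.sub_mul_le_varPressure β R hTI
  rw [← hν] at hS hEn hP
  have hG := vonNeumannEntropy_gibbsBoxDensity_sub hH β n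
  rw [← hρ] at hG
  have hnd : (0 : ℝ) < (n : ℝ) ^ d := by positivity
  -- abbreviations
  set e := ν.meanEnergy Ψ R
  set s := ν.entropyDensitySup
  set T := (Ψ.localHamiltonian (halfOpenBox d n) * ρ).trace.re
  set c := ((Ψ.Φ ∅) ∅ ∅).re
  set K := (((thicken (halfOpenBox d n) R \ halfOpenBox d n).card : ℝ) *
    ∑ X ∈ (thicken ({0} : Finset (Site d)) R).powerset with (0 : Site d) ∈ X, ‖Ψ.Φ X‖)
  -- `β e ≤ β (T − c)/n^d + |β| K/n^d`
  have hβe : β * e ≤ β * ((T - c) / (n : ℝ) ^ d) + |β| * (K / (n : ℝ) ^ d) := by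
    have h := abs_le.1 hEn
    rcases le_or_gt 0 β with hb | hb
    · rw [abs_of_nonneg hb]; nlinarith [h.2]
    · rw [abs_of_neg hb]; nlinarith [h.1]
  -- `log Z = S(ρ) − βT`; `S(ρ)/n^d ≤ s`
  have hlog : Real.log (Matrix.partitionFn β (Ψ.localHamiltonian (halfOpenBox d n))).re = vonNeumannEntropy ρ - β * T := hG.symm
  rw [hlog]
  have e1 : (vonNeumannEntropy ρ - β * T + β * c) / (n : ℝ) ^ d - |β| * (K / (n : ℝ) ^ d) =
      vonNeumannEntropy ρ / (n : ℝ) ^ d - (β * ((T - c) / (n : ℝ) ^ d) + |β| * (K / (n : ℝ) ^ d)) := by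
    field_simp
    ring
  rw [e1]
  linarith

/-- **TWO-SIDED FINITE-BOX WINDOW ON THE VARIATIONAL PRESSURE**: for every `n ≥ 1` and real `β`,
`|P_var(β,Ψ,R) − (log Re Z_{[0,n)^d} + β Re(Ψ∅)_{∅∅})/n^d| ≤ |β| col_R(n) S_Ψ/n^d`. [cite: BratteliRobinsonII1997, Thm. 6.2.40]
[cite: Israel1979, Lemma II.3.1] -/
theorem abs_varPressure_sub_boxLogPartitionFn_le (hd : 0 < d) (hH : Ψ.IsHermitian) (hE : Ψ.IsEven) (hT : Ψ.IsTranslationInvariant)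
    (hR : Ψ.HasFiniteRange R) (β : ℝ) {n : ℕ} (hn : 1 ≤ n) :
    |Ψ.varPressure β R -
        (Real.log (Matrix.partitionFn β (Ψ.localHamiltonian (halfOpenBox d n))).re + β * ((Ψ.Φ ∅) ∅ ∅).re) / (n : ℝ) ^ d| ≤
      |β| * ((((thicken (halfOpenBox d n) R \ halfOpenBox d n).card : ℝ) *
        ∑ X ∈ (thicken ({0} : Finset (Site d)) R).powerset with (0 : Site d) ∈ X, ‖Ψ.Φ X‖) / (n : ℝ) ^ d) := by
  have hlo := le_varPressure_of_box hd hH hE hT hR β hn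
  have hup := InfVolFermionState.varPressure_le_log_partitionFn_box hd hH hT hR β hn
  have hnd : (0 : ℝ) < (n : ℝ) ^ d := by positivity
  have hup' : Ψ.varPressure β R ≤
      (Real.log (Matrix.partitionFn β (Ψ.localHamiltonian (halfOpenBox d n))).re + β * ((Ψ.Φ ∅) ∅ ∅).re) / (n : ℝ) ^ d +
        |β| * ((((thicken (halfOpenBox d n) R \ halfOpenBox d n).card : ℝ) *
          ∑ X ∈ (thicken ({0} : Finset (Site d)) R).powerset with (0 : Site d) ∈ X, ‖Ψ.Φ X‖) / (n : ℝ) ^ d) := by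
    rw [← mul_div_assoc, ← add_div, le_div_iff₀' hnd]
    exact hup
  rw [abs_le]
  constructor
  · linarith
  · linarith

/-- Explicit collar: the window with `col_R(n) ≤ (n + 2⌊R⌋)^d − n^d`. [cite: BratteliKishimotoRobinson1978, Thm. 2 (proof, p. 48)] -/
theorem abs_varPressure_sub_boxLogPartitionFn_le' (hd : 0 < d) (hH : Ψ.IsHermitian) (hE : Ψ.IsEven) (hT : Ψ.IsTranslationInvariant)
    (hR : Ψ.HasFiniteRange R) (β : ℝ) {n : ℕ} (hn : 1 ≤ n) :
    |Ψ.varPressure β R -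
        (Real.log (Matrix.partitionFn β (Ψ.localHamiltonian (halfOpenBox d n))).re + β * ((Ψ.Φ ∅) ∅ ∅).re) / (n : ℝ) ^ d| ≤
      |β| * (((((n + 2 * ⌊R⌋₊) ^ d - n ^ d : ℕ) : ℝ) *
        ∑ X ∈ (thicken ({0} : Finset (Site d)) R).powerset with (0 : Site d) ∈ X, ‖Ψ.Φ X‖) / (n : ℝ) ^ d) := by
  refine (abs_varPressure_sub_boxLogPartitionFn_le hd hH hE hT hR β hn).trans ?_
  have hS : 0 ≤ ∑ X ∈ (thicken ({0} : Finset (Site d)) R).powerset with (0 : Site d) ∈ X, ‖Ψ.Φ X‖ :=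
    Finset.sum_nonneg fun _ _ => norm_nonneg _
  have hc : ((thicken (halfOpenBox d n) R \ halfOpenBox d n).card : ℝ) ≤ (((n + 2 * ⌊R⌋₊) ^ d - n ^ d : ℕ) : ℝ) := by
    exact_mod_cast card_thicken_halfOpenBox_sdiff_le n R
  have hnd : (0 : ℝ) < (n : ℝ) ^ d := by positivity
  exact mul_le_mul_of_nonneg_left (div_le_div_of_nonneg_right (mul_le_mul_of_nonneg_right hc hS) hnd.le) (abs_nonneg β)

/-! ### §3. The thermodynamic limit: `P_var = P_free` -/

/-- **Upper half in the limit**: if `n^{-d} log Re Z_{[0,n)^d} → p` then `p ≤ P_var(β,Ψ,R)` (every real `β`; the collar is `o(n^d)`).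
[cite: BratteliRobinsonII1997, Thm. 6.2.40] [cite: ArakiMoriya2003, Theorem 3.8 and §10] -/
theorem le_varPressure_of_limit (hd : 0 < d) (hH : Ψ.IsHermitian) (hE : Ψ.IsEven) (hT : Ψ.IsTranslationInvariant)
    (hR : Ψ.HasFiniteRange R) (β : ℝ) {p : ℝ}
    (hlim : Tendsto (fun n : ℕ => Real.log (Matrix.partitionFn β (Ψ.localHamiltonian (halfOpenBox d n))).re / ((n : ℝ) ^ d))
      atTop (𝓝 p)) :
    p ≤ Ψ.varPressure β R := by
  set S : ℝ := ∑ X ∈ (thicken ({0} : Finset (Site d)) R).powerset with (0 : Site d) ∈ X, ‖Ψ.Φ X‖ with hSdef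
  set c : ℝ := β * ((Ψ.Φ ∅) ∅ ∅).re with hc
  have hpow : Tendsto (fun n : ℕ => ((n : ℝ) ^ d)) atTop atTop := by
    have h := (tendsto_natCast_atTop_atTop (R := ℝ)).comp (tendsto_pow_atTop (α := ℕ) (ne_of_gt hd))
    refine h.congr fun n => ?_
    simp
  have hc0 : Tendsto (fun n : ℕ => c / ((n : ℝ) ^ d)) atTop (𝓝 0) := tendsto_const_nhds.div_atTop hpow
  have hcol : Tendsto (fun n : ℕ => |β| * ((((thicken (halfOpenBox d n) R \ halfOpenBox d n).card : ℝ) * S) / (n : ℝ) ^ d))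
      atTop (𝓝 0) := by
    have h := ((tendsto_collar_div_pow hd R).mul_const S).const_mul |β|
    rw [zero_mul, mul_zero] at h
    refine h.congr fun n => ?_
    ring
  have hsum := (hlim.add hc0).sub hcol
  rw [add_zero, sub_zero] at hsum
  refine le_of_tendsto hsum ?_
  filter_upwards [Filter.eventually_ge_atTop 1] with n hn
  have h := le_varPressure_of_box hd hH hE hT hR β hn
  rw [← hSdef, add_div] at h
  exact h

/-- **If the box pressures converge, their limit IS the variational pressure** (every real `β`).
[cite: BratteliRobinsonII1997, Thm. 6.2.40] -/
theorem varPressure_eq_of_limit (hd : 0 < d) (hH : Ψ.IsHermitian) (hE : Ψ.IsEven) (hT : Ψ.IsTranslationInvariant)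
    (hR : Ψ.HasFiniteRange R) (β : ℝ) {p : ℝ}
    (hlim : Tendsto (fun n : ℕ => Real.log (Matrix.partitionFn β (Ψ.localHamiltonian (halfOpenBox d n))).re / ((n : ℝ) ^ d))
      atTop (𝓝 p)) :
    Ψ.varPressure β R = p :=
  le_antisymm (InfVolFermionState.varPressure_le_of_limit hd hH hT hR β hlim) (le_varPressure_of_limit hd hH hE hT hR β hlim)

/-- **The free-boundary pressure** `P_free(β,Ψ) = lim_n n^{-d} log Re Tr e^{−βH^Ψ_{[0,n)^d}}` (as `limUnder`; it IS the limit under the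
hypotheses of `tendsto_freePressure`). [cite: BratteliRobinsonII1997, §6.2.4 (Prop. 6.2.39 ff.)] [cite: Israel1979, Thm. I.2.4] -/
def freePressure (β : ℝ) (Ψ : FermionInteraction d) : ℝ :=
  limUnder atTop fun n : ℕ => Real.log (Matrix.partitionFn β (Ψ.localHamiltonian (halfOpenBox d n))).re / ((n : ℝ) ^ d)

/-- **`n^{-d} log Re Z_{[0,n)^d} → P_free(β,Ψ)`** (`d ≥ 1`, `β ≥ 0`, `Ψ` Hermitian even translation covariant of finite range).
[cite: BratteliRobinsonII1997, §6.2.4 (Prop. 6.2.39 ff.)] -/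
theorem tendsto_freePressure (hd : 0 < d) (hH : Ψ.IsHermitian) (hE : Ψ.IsEven) (hT : Ψ.IsTranslationInvariant)
    (hR : Ψ.HasFiniteRange R) {β : ℝ} (hβ : 0 ≤ β) :
    Tendsto (fun n : ℕ => Real.log (Matrix.partitionFn β (Ψ.localHamiltonian (halfOpenBox d n))).re / ((n : ℝ) ^ d))
      atTop (𝓝 (Ψ.freePressure β)) :=
  tendsto_nhds_limUnder (exists_tendsto_boxLogPartitionFn_div hd hH hE hT hR hβ)

/-- **THE GIBBS VARIATIONAL PRINCIPLE**: `P_var(β,Ψ,R) = P_free(β,Ψ)` — the supremum of `s̄(ω) − β e_Ψ(ω)` over translation-invariant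
states of the CAR algebra over `ℤ^d` equals the thermodynamic limit of the free-boundary box pressures, for every Hermitian, even,
translation-covariant interaction of finite range `R` (`d ≥ 1`, `β ≥ 0`). [cite: BratteliRobinsonII1997, Thm. 6.2.40]
[cite: ArakiMoriya2003, Theorem 3.8 and §10] -/
theorem varPressure_eq_freePressure (hd : 0 < d) (hH : Ψ.IsHermitian) (hE : Ψ.IsEven) (hT : Ψ.IsTranslationInvariant)
    (hR : Ψ.HasFiniteRange R) {β : ℝ} (hβ : 0 ≤ β) : Ψ.varPressure β R = Ψ.freePressure β :=
  varPressure_eq_of_limit hd hH hE hT hR β (tendsto_freePressure hd hH hE hT hR hβ)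

/-- The variational pressure does not depend on the range parameter `R ≥` range (both equal `P_free`). [cite: BratteliRobinsonII1997, Thm. 6.2.40] -/
theorem varPressure_eq_varPressure_of_hasFiniteRange (hd : 0 < d) (hH : Ψ.IsHermitian) (hE : Ψ.IsEven) (hT : Ψ.IsTranslationInvariant)
    {R R' : ℝ} (hR : Ψ.HasFiniteRange R) (hR' : Ψ.HasFiniteRange R') {β : ℝ} (hβ : 0 ≤ β) :
    Ψ.varPressure β R = Ψ.varPressure β R' := by
  rw [varPressure_eq_freePressure hd hH hE hT hR hβ, varPressure_eq_freePressure hd hH hE hT hR' hβ]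

/-- **Two-sided finite-box window on the FREE-BOUNDARY PRESSURE**: `|P_free − (log Re Z_n + βc)/n^d| ≤ β col_R(n) S_Ψ/n^d` (`β ≥ 0`, `n ≥ 1`).
[cite: BratteliRobinsonII1997, Thm. 6.2.40] [cite: Israel1979, Lemma II.3.1] -/
theorem abs_freePressure_sub_boxLogPartitionFn_le (hd : 0 < d) (hH : Ψ.IsHermitian) (hE : Ψ.IsEven) (hT : Ψ.IsTranslationInvariant)
    (hR : Ψ.HasFiniteRange R) {β : ℝ} (hβ : 0 ≤ β) {n : ℕ} (hn : 1 ≤ n) :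
    |Ψ.freePressure β -
        (Real.log (Matrix.partitionFn β (Ψ.localHamiltonian (halfOpenBox d n))).re + β * ((Ψ.Φ ∅) ∅ ∅).re) / (n : ℝ) ^ d| ≤
      β * ((((thicken (halfOpenBox d n) R \ halfOpenBox d n).card : ℝ) *
        ∑ X ∈ (thicken ({0} : Finset (Site d)) R).powerset with (0 : Site d) ∈ X, ‖Ψ.Φ X‖) / (n : ℝ) ^ d) := by
  rw [← varPressure_eq_freePressure hd hH hE hT hR hβ]
  have h := abs_varPressure_sub_boxLogPartitionFn_le hd hH hE hT hR β hn
  rwa [abs_of_nonneg hβ] at h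

/-- **The trial principle for the physical pressure**: `s̄(ω) − β e_Ψ(ω) ≤ P_free(β,Ψ)` for every translation-invariant state.
[cite: BratteliRobinsonII1997, Thm. 6.2.40] -/
theorem sub_mul_le_freePressure (hd : 0 < d) (hH : Ψ.IsHermitian) (hE : Ψ.IsEven) (hT : Ψ.IsTranslationInvariant)
    (hR : Ψ.HasFiniteRange R) {β : ℝ} (hβ : 0 ≤ β) {ω : InfVolFermionState d} (hω : ω.IsTranslationInvariant) :
    ω.entropyDensitySup - β * ω.meanEnergy Ψ R ≤ Ψ.freePressure β := by
  rw [← varPressure_eq_freePressure hd hH hE hT hR hβ]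
  exact Ψ.sub_mul_le_varPressure β R hω

end FermionInteraction

/-! ### §4. Dictionary: the grand-canonical `t–t'` Hubbard family -/

section Hubbard

/-- The grand-canonical `t–t'` interaction is Hermitian. [cite: ArakiMoriya2003, §1 assumption (II)] -/
theorem gcInteractionTT'_isHermitian (t t' U μ hz : ℝ) : (gcInteractionTT' t t' U μ hz).IsHermitian :=
  FermionInteraction.isHermitian_linearFamily (hubbardTTPrimeFermionInteraction_isHermitian t t' U)
    (fun a => by fin_cases a <;> [exact numberInteraction_isHermitian; exact spinImbalanceInteraction_isHermitian]) _

/-- The grand-canonical `t–t'` interaction is even. [cite: ArakiMoriya2003, §1 assumption (II)] -/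
theorem gcInteractionTT'_isEven (t t' U μ hz : ℝ) : (gcInteractionTT' t t' U μ hz).IsEven :=
  FermionInteraction.isEven_linearFamily (hubbardTTPrimeFermionInteraction_isEven t t' U)
    (fun a => by fin_cases a <;> [exact numberInteraction_isEven; exact spinImbalanceInteraction_isEven]) _

/-- The grand-canonical `t–t'` interaction is translation covariant. [cite: ArakiMoriya2003, §1 assumption (IV)] -/
theorem gcInteractionTT'_isTranslationInvariant (t t' U μ hz : ℝ) : (gcInteractionTT' t t' U μ hz).IsTranslationInvariant :=
  FermionInteraction.isTranslationInvariant_linearFamily (hubbardTTPrimeFermionInteraction_isTranslationInvariant t t' U)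
    (fun a => by fin_cases a <;> [exact numberInteraction_isTranslationInvariant; exact spinImbalanceInteraction_isTranslationInvariant]) _

/-- The grand-canonical `t–t'` interaction has range `1`. [cite: ArakiMoriya2003, §5.4] -/
theorem gcInteractionTT'_hasFiniteRange (t t' U μ hz : ℝ) : (gcInteractionTT' t t' U μ hz).HasFiniteRange 1 :=
  FermionInteraction.hasFiniteRange_linearFamily (hubbardTTPrimeFermionInteraction_hasFiniteRange t t' U)
    (fun a => by fin_cases a <;> [exact numberInteraction_hasFiniteRange 1 zero_le_one; exact spinImbalanceInteraction_hasFiniteRange 1 zero_le_one]) _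

/-- **The free-boundary box pressure of the 2D grand-canonical `t–t'` Hubbard model converges to `gcPressureTT'Zeeman`**
(`β ≥ 0`, `U ≥ 0`): free-boundary boxes and the torus grand-canonical pressure of record agree in the thermodynamic limit.
[cite: BratteliRobinsonII1997, Thm. 6.2.40] -/
theorem freePressure_gcInteractionTT'_eq {β : ℝ} (hβ : 0 ≤ β) (t t' : ℝ) {U : ℝ} (hU : 0 ≤ U) (μ hz : ℝ) :
    (gcInteractionTT' t t' U μ hz).freePressure β = gcPressureTT'Zeeman β t t' U μ hz := by
  rw [← (gcInteractionTT' t t' U μ hz).varPressure_eq_freePressure (by norm_num) (gcInteractionTT'_isHermitian t t' U μ hz)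
    (gcInteractionTT'_isEven t t' U μ hz) (gcInteractionTT'_isTranslationInvariant t t' U μ hz) (gcInteractionTT'_hasFiniteRange t t' U μ hz) hβ]
  exact varPressure_gcInteractionTT'_eq hβ t t' hU μ hz

/-- … i.e. `n^{-2} log Re Tr e^{−β(H_{[0,n)²} − μN − hM)} → gcPressureTT'Zeeman β t t' U μ h` along free-boundary boxes.
[cite: BratteliRobinsonII1997, §6.2.4 (Prop. 6.2.39 ff.)] -/
theorem tendsto_boxLogPartitionFn_gcInteractionTT' {β : ℝ} (hβ : 0 ≤ β) (t t' : ℝ) {U : ℝ} (hU : 0 ≤ U) (μ hz : ℝ) :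
    Tendsto (fun n : ℕ => Real.log (Matrix.partitionFn β ((gcInteractionTT' t t' U μ hz).localHamiltonian (halfOpenBox 2 n))).re / ((n : ℝ) ^ 2))
      atTop (𝓝 (gcPressureTT'Zeeman β t t' U μ hz)) := by
  rw [← freePressure_gcInteractionTT'_eq hβ t t' hU μ hz]
  exact (gcInteractionTT' t t' U μ hz).tendsto_freePressure (by norm_num) (gcInteractionTT'_isHermitian t t' U μ hz)
    (gcInteractionTT'_isEven t t' U μ hz) (gcInteractionTT'_isTranslationInvariant t t' U μ hz) (gcInteractionTT'_hasFiniteRange t t' U μ hz) hβ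

end Hubbard

end Literature.MathematicalPhysics.QuantumLattice

end
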